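import Literature.Analysis.FluidPDE.ElgindiWeightedEnergyBound
import Literature.Analysis.FluidPDE.ElgindiSliceBoundary
import HarnessLib

/-!
# The radially weighted Hardy bound on the energy space
([Elgindi2021] §7.2 Lemma 7.2 with the radial weight of §1.7.2)

Topic `Literature/Analysis/FluidPDE`. Proof file (everything proved, no definitions, no named
facts) on the proof path of the named fact
`Literature.Analysis.FluidPDE.Elgindi.ElgindiGhoulMasmoudi2021_stabilityCore`
(`ElgindiStabilityDecomposition.lean`). T. M. Elgindi, Ann. of Math. 194 (2021) =
arXiv:1904.04795, §7.2 Lemma 7.2 (p. 20) and §1.7.2 (p. 7: `w = (1+R)²/R²`).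

`∫∫_strip w²U₀²/sin²(2θ) ≤ 10∫∫_strip w²U₂²` for every `U` in the energy space
(`lintegral_weightedHardy_weakSpace`): with the bounded regularised weights `W_ε` of
`ElgindiWeightedEnergyBound.lean` the inequality holds on graphs (Lemma 7.2 slice by slice), its
right-hand side is continuous and its left-hand side lower semicontinuous on `E⁴`, so it passes to
the closure; then `ε ↓ 0` by monotone convergence. Hence `wU₀/sin(2θ) ∈ L²` as soon as
`wU₂ ∈ L²` (`integrableOn_weighted_sq_div_sin_sq`).
-/

noncomputable section

open MeasureTheory Set Real Filter Function
open _root_.Topology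
open scoped ENNReal InnerProductSpace

namespace Literature.Analysis.FluidPDE

namespace Elgindi

/-- **Lemma 7.2 with the weight `W_ε` on graphs, strip form.** [cite: Elgindi2021, §7.2 Lemma 7.2 (p. 20 of arXiv:1904.04795)] -/
theorem lintegral_hardyW_graphElt (α : ℝ) {ε : ℝ} (hε : 0 < ε) {χ : ℝ → ℝ → ℝ} (hχ : χ ∈ orthClass) :
    ∫⁻ p in strip, ENNReal.ofReal (approxWeight ε p.1 * ((graphElt α χ 0 : ℝ × ℝ → ℝ) p ^ 2 / Real.sin (2 * p.2) ^ 2)) ≤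
      ENNReal.ofReal (10 * ⟪mulW hε (graphElt α χ 2), graphElt α χ 2⟫_ℝ) := by
  obtain ⟨hsm, hs, -, hχ0, -⟩ := hχ
  have h1 : ContDiff ℝ 1 (uncurry χ) := hsm 1
  obtain ⟨Ψ, hΨ⟩ : ∃ Ψ : ℝ → ℝ → ℝ, Ψ = fun R θ => Real.cos θ * χ R θ := ⟨_, rfl⟩
  have hΨ1 : ContDiff ℝ 1 (uncurry Ψ) := by rw [hΨ]; exact contDiff_cosProfile h1
  have hΨs : HasCompactSupport (uncurry Ψ) := by rw [hΨ]; exact hasCompactSupport_cosProfile hs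
  have hD0 : ∀ R, Ψ R 0 = 0 := fun R => by rw [hΨ]; simp [hχ0 R]
  have hD1 : ∀ R, Ψ R (π / 2) = 0 := fun R => by rw [hΨ]; simp
  have g0 : ∀ p : ℝ × ℝ, graphFn α χ 0 p = Ψ p.1 p.2 := fun p => by rw [hΨ]; rfl
  have g2 : ∀ p : ℝ × ℝ, graphFn α χ 2 p = dθ Ψ p.1 p.2 := fun p => by
    show -Real.sin p.2 * χ p.1 p.2 + Real.cos p.2 * dθ χ p.1 p.2 = _; rw [hΨ, dθ_cosProfile h1]
  -- replace the `L²` representative by `Ψ` on the left, compute the right-hand side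
  have hae := toL2_ae_eq' (memLp_graphFn h1 hs 0 (α := α))
  have eL : ∫⁻ p in strip, ENNReal.ofReal (approxWeight ε p.1 * ((graphElt α χ 0 : ℝ × ℝ → ℝ) p ^ 2 / Real.sin (2 * p.2) ^ 2)) =
      ∫⁻ p in strip, ENNReal.ofReal (approxWeight ε p.1 * (Ψ p.1 p.2 ^ 2 / Real.sin (2 * p.2) ^ 2)) := by
    refine lintegral_congr_ae ?_
    filter_upwards [hae] with p hp
    rw [graphElt_apply, hp, g0]
  rw [eL, graphElt_apply, show mulW hε = mulL2 (measurable_bW hε) (bW_bound hε) from rfl, inner_mulL2_toL2 _ _ (memLp_graphFn h1 hs 2)]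
  simp only [g2]
  -- Tonelli on the left
  have cW : Continuous fun p : ℝ × ℝ => approxWeight ε p.1 := (contDiff_approxWeight hε (n := 0)).continuous.comp continuous_fst
  have hmeas : Measurable fun p : ℝ × ℝ => ENNReal.ofReal (approxWeight ε p.1 * (Ψ p.1 p.2 ^ 2 / Real.sin (2 * p.2) ^ 2)) :=
    (cW.measurable.mul (measurable_sq_div_sin_sq (hΨ1.continuous.measurable))).ennreal_ofReal
  have hprod : (volume.restrict strip : Measure (ℝ × ℝ)) = (volume.restrict (Ioi (0:ℝ))).prod (volume.restrict (Ioo 0 (π / 2))) := by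
    rw [show strip = Ioi (0:ℝ) ×ˢ Ioo 0 (π / 2) from rfl, Measure.volume_eq_prod, Measure.prod_restrict]
  -- the right-hand side as an iterated integral
  have cdθ : Continuous fun p : ℝ × ℝ => dθ Ψ p.1 p.2 := (contDiff_dθ_of_contDiff (n := 0) hΨ1).continuous
  have sY : HasCompactSupport fun p : ℝ × ℝ => bW ε p * dθ Ψ p.1 p.2 ^ 2 := by
    have : (fun p : ℝ × ℝ => dθ Ψ p.1 p.2 ^ 2) = fun p : ℝ × ℝ => dθ Ψ p.1 p.2 * dθ Ψ p.1 p.2 := by funext p; ring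
    have h2 : HasCompactSupport fun p : ℝ × ℝ => dθ Ψ p.1 p.2 ^ 2 := by rw [this]; exact (hasCompactSupport_dθ_of hΨs).mul_left
    exact h2.mul_left
  have iY : Integrable fun p : ℝ × ℝ => bW ε p * dθ Ψ p.1 p.2 ^ 2 := (cW.mul (cdθ.pow 2)).integrable_of_hasCompactSupport sY
  rw [integral_strip_eq_integral_Ioi_integral_Ioo iY]
  rw [hprod, lintegral_prod _ hmeas.aemeasurable]
  -- slice inequality, with the weight `W_ε(R) ≥ 0`
  have hslice : ∀ R, 0 ≤ R → ∫⁻ θ in Ioo 0 (π / 2), ENNReal.ofReal (approxWeight ε R * (Ψ R θ ^ 2 / Real.sin (2 * θ) ^ 2)) ≤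
      ENNReal.ofReal (10 * ∫ θ in Ioo 0 (π / 2), bW ε (R, θ) * dθ Ψ R θ ^ 2) := by
    intro R hR
    obtain ⟨hI, hle⟩ := hardy_slice hΨ1 hD0 hD1 R
    have hW0 := (approxWeight_pos hε hR).le
    rw [← ofReal_integral_eq_lintegral_ofReal (hI.const_mul _) (ae_of_all _ fun θ => by positivity)]
    refine ENNReal.ofReal_le_ofReal ?_
    rw [MeasureTheory.integral_const_mul]
    have e2 : ∫ θ in Ioo 0 (π / 2), bW ε (R, θ) * dθ Ψ R θ ^ 2 = approxWeight ε R * ∫ θ in Ioo 0 (π / 2), dθ Ψ R θ ^ 2 := by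
      rw [← MeasureTheory.integral_const_mul]; rfl
    rw [e2]
    nlinarith [mul_le_mul_of_nonneg_left hle hW0]
  have iInner : Integrable (fun R => ∫ θ in Ioo 0 (π / 2), bW ε (R, θ) * dθ Ψ R θ ^ 2) (volume.restrict (Ioi (0:ℝ))) := by
    have := iY.integrableOn (s := strip)
    rw [IntegrableOn, hprod] at this
    exact this.integral_prod_left
  have hnn : ∀ R ∈ Ioi (0:ℝ), 0 ≤ ∫ θ in Ioo 0 (π / 2), bW ε (R, θ) * dθ Ψ R θ ^ 2 := fun R hR =>
    setIntegral_nonneg measurableSet_Ioo fun θ _ => mul_nonneg (approxWeight_pos hε (le_of_lt hR)).le (sq_nonneg _)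
  calc ∫⁻ R in Ioi 0, ∫⁻ θ in Ioo 0 (π / 2), ENNReal.ofReal (approxWeight ε (R, θ).1 * (Ψ (R, θ).1 (R, θ).2 ^ 2 / Real.sin (2 * (R, θ).2) ^ 2))
      ≤ ∫⁻ R in Ioi 0, ENNReal.ofReal (10 * ∫ θ in Ioo 0 (π / 2), bW ε (R, θ) * dθ Ψ R θ ^ 2) :=
        setLIntegral_mono' measurableSet_Ioi fun R hR => hslice R (le_of_lt hR)
    _ = ENNReal.ofReal (∫ R in Ioi 0, 10 * ∫ θ in Ioo 0 (π / 2), bW ε (R, θ) * dθ Ψ R θ ^ 2) := by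
        rw [← ofReal_integral_eq_lintegral_ofReal (iInner.const_mul 10)]
        rw [Filter.EventuallyLE, ae_restrict_iff' measurableSet_Ioi]
        exact ae_of_all _ fun R hR => by have := hnn R hR; show (0:ℝ) ≤ 10 * _; positivity
    _ = ENNReal.ofReal (10 * ∫ R in Ioi 0, ∫ θ in Ioo 0 (π / 2), bW ε (R, θ) * dθ Ψ R θ ^ 2) := by rw [MeasureTheory.integral_const_mul]

set_option maxHeartbeats 1600000 in
/-- **Lemma 7.2 with the weight `W_ε` on the energy space** (lower semicontinuity of the left-hand
side, continuity of the right-hand side on `E⁴`). [folklore] -/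
theorem lintegral_hardyW_weakSpace {α ε : ℝ} (hε : 0 < ε) {U : E4} (hU : U ∈ weakSpace α) :
    ∫⁻ p in strip, ENNReal.ofReal (approxWeight ε p.1 * ((U 0 : ℝ × ℝ → ℝ) p ^ 2 / Real.sin (2 * p.2) ^ 2)) ≤
      ENNReal.ofReal (10 * ⟪mulW hε (U 2), U 2⟫_ℝ) := by
  have hU' : U ∈ closure ((LinearMap.range (graphL α) : Set E4)) := by
    rw [← Submodule.topologicalClosure_coe]; exact hU
  obtain ⟨V, hV, hlim⟩ := mem_closure_iff_seq_limit.1 hU'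
  choose χ hχ using fun n => (LinearMap.mem_range.1 (hV n))
  have hVn : ∀ n, V n = graphElt α (χ n) := fun n => by rw [← hχ n]; rfl
  have hc : ∀ k : Fin 4, Continuous fun W : E4 => W k := fun k => (PiLp.proj 2 (𝕜 := ℝ) (fun _ : Fin 4 => L2Strip) k).continuous
  have h0 : Tendsto (fun n => V n 0) atTop (𝓝 (U 0)) := ((hc 0).tendsto U).comp hlim
  have hQ : Continuous fun W : E4 => ⟪mulW hε (W 2), W 2⟫_ℝ := ((mulW hε).continuous.comp (hc 2)).inner (hc 2)
  have h2 : Tendsto (fun n => ⟪mulW hε (V n 2), V n 2⟫_ℝ) atTop (𝓝 ⟪mulW hε (U 2), U 2⟫_ℝ) := (hQ.tendsto U).comp hlim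
  have hm := tendstoInMeasure_of_tendsto_Lp h0
  obtain ⟨ns, hns, hae⟩ := hm.exists_seq_tendsto_ae
  set G : ℕ → ℝ × ℝ → ℝ≥0∞ := fun k p => ENNReal.ofReal (approxWeight ε p.1 * ((V (ns k) 0 : ℝ × ℝ → ℝ) p ^ 2 / Real.sin (2 * p.2) ^ 2)) with hG
  have hWm : Measurable fun p : ℝ × ℝ => approxWeight ε p.1 := (contDiff_approxWeight hε (n := 0)).continuous.measurable.comp measurable_fst
  have hGm : ∀ k, AEMeasurable (G k) (volume.restrict strip) := fun k =>
    (hWm.aemeasurable.mul (((Lp.aestronglyMeasurable (V (ns k) 0)).aemeasurable.pow_const 2).div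
      ((Real.continuous_sin.measurable.comp (measurable_const.mul measurable_snd)).pow_const 2).aemeasurable)).ennreal_ofReal
  have hlim' : ∀ᵐ p ∂(volume.restrict strip), Tendsto (fun k => G k p) atTop
      (𝓝 (ENNReal.ofReal (approxWeight ε p.1 * ((U 0 : ℝ × ℝ → ℝ) p ^ 2 / Real.sin (2 * p.2) ^ 2)))) := by
    filter_upwards [hae] with p hp
    exact ENNReal.tendsto_ofReal (((hp.pow 2).div_const _).const_mul _)
  have hF : ∫⁻ p in strip, ENNReal.ofReal (approxWeight ε p.1 * ((U 0 : ℝ × ℝ → ℝ) p ^ 2 / Real.sin (2 * p.2) ^ 2)) ≤ liminf (fun k => ∫⁻ p in strip, G k p) atTop := by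
    calc ∫⁻ p in strip, ENNReal.ofReal (approxWeight ε p.1 * ((U 0 : ℝ × ℝ → ℝ) p ^ 2 / Real.sin (2 * p.2) ^ 2))
        = ∫⁻ p in strip, liminf (fun k => G k p) atTop := lintegral_congr_ae (by
            filter_upwards [hlim'] with p hp; exact hp.liminf_eq.symm)
      _ ≤ liminf (fun k => ∫⁻ p in strip, G k p) atTop := lintegral_liminf_le' hGm
  have hGk : ∀ k, ∫⁻ p in strip, G k p ≤ ENNReal.ofReal (10 * ⟪mulW hε (V (ns k) 2), V (ns k) 2⟫_ℝ) := fun k => by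
    simp only [hG, hVn]; exact lintegral_hardyW_graphElt α hε (χ (ns k)).2
  have hR : Tendsto (fun k => ENNReal.ofReal (10 * ⟪mulW hε (V (ns k) 2), V (ns k) 2⟫_ℝ)) atTop (𝓝 (ENNReal.ofReal (10 * ⟪mulW hε (U 2), U 2⟫_ℝ))) :=
    ENNReal.tendsto_ofReal ((h2.comp hns.tendsto_atTop).const_mul 10)
  calc ∫⁻ p in strip, ENNReal.ofReal (approxWeight ε p.1 * ((U 0 : ℝ × ℝ → ℝ) p ^ 2 / Real.sin (2 * p.2) ^ 2))
      ≤ liminf (fun k => ∫⁻ p in strip, G k p) atTop := hF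
    _ ≤ liminf (fun k => ENNReal.ofReal (10 * ⟪mulW hε (V (ns k) 2), V (ns k) 2⟫_ℝ)) atTop := liminf_le_liminf (Eventually.of_forall hGk)
    _ = ENNReal.ofReal (10 * ⟪mulW hε (U 2), U 2⟫_ℝ) := hR.liminf_eq

/-- **The radially weighted Hardy bound on the energy space**: if `wU₂ ∈ L²(strip)` then
`∫∫ w²U₀²/sin²(2θ) ≤ 10∫∫ w²U₂²` (`w = (1+R)²/R²`). [cite: Elgindi2021, §7.2 Lemma 7.2 (p. 20) and §1.7.2 (p. 7 of arXiv:1904.04795)] -/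
theorem lintegral_weightedHardy_weakSpace {α : ℝ} {U : E4} (hU : U ∈ weakSpace α)
    (hfin : IntegrableOn (fun p : ℝ × ℝ => radialWeight p.1 ^ 2 * (U 2 : ℝ × ℝ → ℝ) p ^ 2) strip) :
    ∫⁻ p in strip, ENNReal.ofReal (radialWeight p.1 ^ 2 * ((U 0 : ℝ × ℝ → ℝ) p ^ 2 / Real.sin (2 * p.2) ^ 2)) ≤
      ENNReal.ofReal (10 * ∫ p in strip, radialWeight p.1 ^ 2 * (U 2 : ℝ × ℝ → ℝ) p ^ 2) := by
  set M := ∫ p in strip, radialWeight p.1 ^ 2 * (U 2 : ℝ × ℝ → ℝ) p ^ 2 with hM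
  set u : ℝ × ℝ → ℝ := (U 0 : ℝ × ℝ → ℝ)
  -- level `ε`: `≤ ofReal (10 M)`
  have hlev : ∀ {ε : ℝ} (hε : 0 < ε), ∫⁻ p in strip, ENNReal.ofReal (approxWeight ε p.1 * (u p ^ 2 / Real.sin (2 * p.2) ^ 2)) ≤ ENNReal.ofReal (10 * M) := by
    intro ε hε
    refine (lintegral_hardyW_weakSpace hε hU).trans (ENNReal.ofReal_le_ofReal ?_)
    rw [inner_mulW_eq]
    refine mul_le_mul_of_nonneg_left ?_ (by norm_num)
    have i1 : IntegrableOn (fun p : ℝ × ℝ => approxWeight ε p.1 * (U 2 : ℝ × ℝ → ℝ) p ^ 2) strip := by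
      have mWU : MemLp (fun p => bW ε p * (U 2 : ℝ × ℝ → ℝ) p) 2 stripMeasure := memLp_mul_of_bound (measurable_bW hε) (bW_bound hε) (U 2)
      have i1 : Integrable (fun p => bW ε p * (U 2 : ℝ × ℝ → ℝ) p * (U 2 : ℝ × ℝ → ℝ) p) stripMeasure := mWU.integrable_mul (Lp.memLp (U 2))
      exact i1.congr (ae_of_all _ fun p => by show approxWeight ε p.1 * _ * _ = _; ring)
    exact setIntegral_mono_on i1 hfin measurableSet_strip fun p hp =>
      mul_le_mul_of_nonneg_right (approxWeight_le_radialWeight_sq hε hp.1) (sq_nonneg _)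
  -- monotone convergence along `ε_n = 1/(n+1)`
  have hum : AEStronglyMeasurable u (volume.restrict strip) := (Lp.memLp (U 0)).1
  have hsm : Measurable fun p : ℝ × ℝ => Real.sin (2 * p.2) ^ 2 := (Real.continuous_sin.measurable.comp (measurable_const.mul measurable_snd)).pow_const 2
  set G : ℕ → ℝ × ℝ → ℝ≥0∞ := fun n p => ENNReal.ofReal (approxWeight (1 / ((n:ℝ) + 1)) p.1 * (u p ^ 2 / Real.sin (2 * p.2) ^ 2)) with hG
  have hεn : ∀ n : ℕ, (0:ℝ) < 1 / ((n:ℝ) + 1) := fun n => by positivity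
  have hGm : ∀ n, AEMeasurable (G n) (volume.restrict strip) := fun n =>
    ((((contDiff_approxWeight (hεn n) (n := 0)).continuous.measurable.comp measurable_fst).aemeasurable.mul
      ((hum.aemeasurable.pow_const 2).div hsm.aemeasurable))).ennreal_ofReal
  have hGmono : ∀ᵐ p ∂(volume.restrict strip), Monotone fun n => G n p := by
    rw [ae_restrict_iff' measurableSet_strip]
    refine ae_of_all _ fun p _ => fun m n hmn => ?_
    refine ENNReal.ofReal_le_ofReal (mul_le_mul_of_nonneg_right ?_ (by positivity))
    have hmn' : (m:ℝ) ≤ n := by exact_mod_cast hmn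
    exact approxWeight_mono (hεn n) (one_div_le_one_div_of_le (by positivity) (by linarith)) p.1
  have hGlim : ∀ᵐ p ∂(volume.restrict strip), Tendsto (fun n => G n p) atTop (𝓝 (ENNReal.ofReal (radialWeight p.1 ^ 2 * (u p ^ 2 / Real.sin (2 * p.2) ^ 2)))) := by
    rw [ae_restrict_iff' measurableSet_strip]
    refine ae_of_all _ fun p hp => ?_
    have ht : Tendsto (fun n : ℕ => 1 / ((n:ℝ) + 1)) atTop (𝓝[>] 0) :=
      tendsto_nhdsWithin_iff.2 ⟨tendsto_one_div_add_atTop_nhds_zero_nat, Eventually.of_forall fun n => hεn n⟩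
    exact ENNReal.tendsto_ofReal (((tendsto_approxWeight hp.1).comp ht).mul_const _)
  have hconv := lintegral_tendsto_of_tendsto_of_monotone hGm hGmono hGlim
  have hle : ∫⁻ p in strip, ENNReal.ofReal (radialWeight p.1 ^ 2 * (u p ^ 2 / Real.sin (2 * p.2) ^ 2)) ≤ ENNReal.ofReal (10 * M) :=
    le_of_tendsto' hconv fun n => hlev (hεn n)
  exact (le_of_eq (lintegral_congr_ae (ae_of_all _ fun p => rfl))).trans hle

/-- **`wU₀/sin(2θ) ∈ L²(strip)` on the energy space when `wU₂ ∈ L²`.** [folklore] -/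
theorem integrableOn_weighted_sq_div_sin_sq {α : ℝ} {U : E4} (hU : U ∈ weakSpace α)
    (hfin : IntegrableOn (fun p : ℝ × ℝ => radialWeight p.1 ^ 2 * (U 2 : ℝ × ℝ → ℝ) p ^ 2) strip) :
    IntegrableOn (fun p : ℝ × ℝ => radialWeight p.1 ^ 2 * ((U 0 : ℝ × ℝ → ℝ) p ^ 2 / Real.sin (2 * p.2) ^ 2)) strip := by
  have hw : Measurable fun p : ℝ × ℝ => radialWeight p.1 ^ 2 := by unfold radialWeight; fun_prop
  have hm : AEStronglyMeasurable (fun p : ℝ × ℝ => radialWeight p.1 ^ 2 * ((U 0 : ℝ × ℝ → ℝ) p ^ 2 / Real.sin (2 * p.2) ^ 2)) (volume.restrict strip) :=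
    (hw.aemeasurable.mul (((Lp.aestronglyMeasurable (U 0)).aemeasurable.pow_const 2).div
      ((Real.continuous_sin.measurable.comp (measurable_const.mul measurable_snd)).pow_const 2).aemeasurable)).aestronglyMeasurable
  refine ⟨hm, ?_⟩
  rw [hasFiniteIntegral_iff_ofReal (ae_of_all _ fun p => by positivity)]
  exact (lintegral_weightedHardy_weakSpace hU hfin).trans_lt ENNReal.ofReal_lt_top

end Elgindi

end Literature.Analysis.FluidPDE
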